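import Literature.MathematicalPhysics.QuantumLattice.ChordGaugeBounds
import Literature.Analysis.OperatorTheory.CayleyUnitaryDeriv
import Mathlib.Analysis.SpecialFunctions.SmoothTransition
import HarnessLib

/-!
# Gluing the two pole gauges into one unitary gauge near the sphere `S_r ⊂ ℝ⁴`

QuantumLattice support file (everything proved; definitions with bodies, no named facts) on the
proof path of `Literature.MathematicalPhysics.QuantumLattice.Waldron2019_yangMillsFlow_flatTorus`
(A. Waldron, Invent. math. 217 (2019)), Lemma 3.5 / §4: from the pole gauges `g₊, g₋`
(`ChordGaugeBounds`) and the Cayley interpolation (`CayleyUnitary(Deriv)`) we build the glued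
unitary gauge transformation `gluedGauge = g₊ · k` on the open shell
`gluedNbhd r = {4r/5 < ‖z‖ < 5r/4}`:

* `gluedStep` — the smooth step `χ` (`= 1` for `t ≤ −1/8`, `= 0` for `t ≥ 1/8`), with a global
  derivative bound `exists_deriv_gluedStep_bound`;
* `gluedW = h h(p)⋆`, `gluedS = cayleyUInv ∘ gluedW`, `gluedT = χ(z₀/r) • gluedS`,
  `gluedK = if z₀ ≤ −r/5 then gluedW else cayleyU ∘ gluedT`, `gluedGauge = g₊ · gluedK`;
* `gluedK_eq_one_of`, `gluedK_eq_cayleyU_of`, `gluedK_eq_W_of` — the three local descriptions;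
* `contDiffOn_gluedK`, `contDiffOn_gluedGauge` — smoothness on the shell;
* `gluedK_mem_unitary`, `gluedGauge_mem_unitary` — unitarity on the shell.

References: A. Waldron, Invent. math. 217 (2019), Lemma 3.5 / §4 [Waldron2019]; K. Uhlenbeck,
Comm. Math. Phys. 83 (1982) [folklore].
-/

noncomputable section

open scoped RealInnerProductSpace Matrix.Norms.Frobenius ContDiff Topology
open Set Metric Filter
open Literature.Analysis.InnerProduct Literature.Analysis.OperatorTheory

namespace Literature.MathematicalPhysics.QuantumLattice

variable {N : ℕ}

local notation "𝔼" => EuclideanSpace ℝ (Fin 4)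
local notation "𝕓" => EuclideanSpace.basisFun (Fin 4) ℝ
local notation "𝔤" => Matrix (Fin N) (Fin N) ℂ

/-! ### The smooth step -/

/-- The smooth step `χ(t) = smoothTransition(1/2 − 4t)`: `1` for `t ≤ −1/8`, `0` for `t ≥ 1/8`.
[folklore] -/
def gluedStep (t : ℝ) : ℝ := Real.smoothTransition (1 / 2 - 4 * t)

/-- `χ = 1` for `t ≤ −1/8`. [folklore] -/
theorem gluedStep_of_le {t : ℝ} (ht : t ≤ -(1 / 8)) : gluedStep t = 1 :=
  Real.smoothTransition.one_of_one_le (by linarith)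

/-- `χ = 0` for `t ≥ 1/8`. [folklore] -/
theorem gluedStep_of_ge {t : ℝ} (ht : 1 / 8 ≤ t) : gluedStep t = 0 :=
  Real.smoothTransition.zero_of_nonpos (by linarith)

/-- `0 ≤ χ`. [folklore] -/
theorem gluedStep_nonneg (t : ℝ) : 0 ≤ gluedStep t := Real.smoothTransition.nonneg _

/-- `χ ≤ 1`. [folklore] -/
theorem gluedStep_le_one (t : ℝ) : gluedStep t ≤ 1 := Real.smoothTransition.le_one _

/-- `χ` is smooth. [folklore] -/
theorem contDiff_gluedStep {n : ℕ∞} : ContDiff ℝ n gluedStep :=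
  Real.smoothTransition.contDiff.comp (contDiff_const.sub (contDiff_const.mul contDiff_id))

/-- **A global bound for `χ'`** (`χ'` is continuous and vanishes off `[−1/8, 1/8]`). [folklore] -/
theorem exists_deriv_gluedStep_bound : ∃ C : ℝ, 0 ≤ C ∧ ∀ t, ‖deriv gluedStep t‖ ≤ C := by
  have hd : Continuous (deriv gluedStep) := (contDiff_gluedStep (n := 1)).continuous_deriv le_rfl
  obtain ⟨C, hC⟩ := isCompact_Icc.exists_bound_of_continuousOn (hd.continuousOn (s := Icc (-(1/8 : ℝ)) (1/8)))
  refine ⟨max C 0, le_max_right _ _, fun t => ?_⟩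
  by_cases ht : t ∈ Icc (-(1/8 : ℝ)) (1/8)
  · exact (hC t ht).trans (le_max_left _ _)
  · -- off the interval `χ` is locally constant
    have hzero : deriv gluedStep t = 0 := by
      rcases not_and_or.1 (by simpa only [mem_Icc] using ht) with h1 | h1
      · have hlt : t < -(1/8) := not_le.1 h1
        have hev : gluedStep =ᶠ[𝓝 t] fun _ => (1 : ℝ) := by
          filter_upwards [Iio_mem_nhds hlt] with s hs
          exact gluedStep_of_le hs.le
        rw [hev.deriv_eq]; simp
      · have hgt : 1/8 < t := not_le.1 h1
        have hev : gluedStep =ᶠ[𝓝 t] fun _ => (0 : ℝ) := by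
          filter_upwards [Ioi_mem_nhds hgt] with s hs
          exact gluedStep_of_ge hs.le
        rw [hev.deriv_eq]; simp
    rw [hzero, norm_zero]; exact le_max_right _ _

/-! ### The glued gauge transformation: definitions -/

section Defs

/-- The pole `c = r e₀`. [folklore] -/
def poleP (r : ℝ) : 𝔼 := (r : ℝ) • 𝕓 0

/-- The base point `p = r e₁` of the band. [folklore] -/
def baseP (r : ℝ) : 𝔼 := (r : ℝ) • 𝕓 1

/-- The normalized transition `W(z) = h(z) h(p)⋆`, `h = g₊⁻¹ g₋`. [folklore] -/
def gluedW {A : Connection 𝔼 𝔤} (hA : ContDiff ℝ 1 A) (r : ℝ) (z : 𝔼) : 𝔤 :=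
  gaugeTransition hA (poleP r) (-poleP r) z * star (gaugeTransition hA (poleP r) (-poleP r) (baseP r))

/-- `S = cayleyUInv ∘ W` (skew and small on the band). [folklore] -/
def gluedS {A : Connection 𝔼 𝔤} (hA : ContDiff ℝ 1 A) (r : ℝ) (z : 𝔼) : 𝔤 := cayleyUInv (gluedW hA r z)

/-- `T(z) = χ(z₀/r) S(z)`. [folklore] -/
def gluedT {A : Connection 𝔼 𝔤} (hA : ContDiff ℝ 1 A) (r : ℝ) (z : 𝔼) : 𝔤 :=
  gluedStep (⟪z, 𝕓 0⟫ / r) • gluedS hA r z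

/-- **The interpolating unitary** `k = W` on `{z₀ ≤ −r/5}`, `= cayleyU(T)` elsewhere. [folklore] -/
def gluedK {A : Connection 𝔼 𝔤} (hA : ContDiff ℝ 1 A) (r : ℝ) (z : 𝔼) : 𝔤 := by
  classical
  exact if ⟪z, 𝕓 0⟫ ≤ -(r / 5) then gluedW hA r z else cayleyU (gluedT hA r z)

/-- **The glued gauge transformation** `g = g₊ k`. [folklore] -/
def gluedGauge {A : Connection 𝔼 𝔤} (hA : ContDiff ℝ 1 A) (r : ℝ) (z : 𝔼) : 𝔤 :=
  expGauge (poleP r) A z * gluedK hA r z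

/-- The open shell `{4r/5 < ‖z‖ < 5r/4}` around `S_r` on which the glued gauge is used.
[folklore] -/
def gluedNbhd (r : ℝ) : Set 𝔼 := {z | 4 / 5 * r < ‖z‖ ∧ ‖z‖ < 5 / 4 * r}

/-- Auxiliary lemma (see the module docstring). [folklore] -/
theorem isOpen_gluedNbhd (r : ℝ) : IsOpen (gluedNbhd r) :=
  (isOpen_lt continuous_const continuous_norm).inter (isOpen_lt continuous_norm continuous_const)

end Defs

/-! ### The three local descriptions of `k` -/

section Local

/-- On `{z₀ ≥ r/8}`: `k = 1`. [folklore] -/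
theorem gluedK_eq_one_of {A : Connection 𝔼 𝔤} (hA : ContDiff ℝ 1 A) {r : ℝ} (hr : 0 < r) {z : 𝔼}
    (hz : r / 8 ≤ ⟪z, 𝕓 0⟫) : gluedK hA r z = 1 := by
  have hif : ¬ ⟪z, 𝕓 0⟫ ≤ -(r / 5) := by intro h; linarith
  unfold gluedK
  rw [if_neg hif, gluedT, gluedStep_of_ge (by rw [le_div_iff₀ hr]; linarith), zero_smul, cayleyU_zero]

/-- On `{z₀ > −3r/10}` at points where the Cayley pair is valid: `k = cayleyU(T)`. [folklore] -/
theorem gluedK_eq_cayleyU_of {A : Connection 𝔼 𝔤} (hA : ContDiff ℝ 1 A) {r : ℝ} (hr : 0 < r) {z : 𝔼}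
    (hgood : ⟪z, 𝕓 0⟫ ≤ -(r / 5) → ‖gluedW hA r z - 1‖ < 2 ∧ ‖gluedS hA r z‖ < 1) :
    gluedK hA r z = cayleyU (gluedT hA r z) := by
  unfold gluedK
  by_cases hif : ⟪z, 𝕓 0⟫ ≤ -(r / 5)
  · rw [if_pos hif, gluedT, gluedStep_of_le (by rw [div_le_iff₀ hr]; linarith), one_smul, gluedS,
      cayleyU_cayleyUInv (hgood hif).1 (hgood hif).2]
  · rw [if_neg hif]

/-- On `{z₀ < −r/8}` at points where the Cayley pair is valid: `k = W`. [folklore] -/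
theorem gluedK_eq_W_of {A : Connection 𝔼 𝔤} (hA : ContDiff ℝ 1 A) {r : ℝ} (hr : 0 < r) {z : 𝔼}
    (hz : ⟪z, 𝕓 0⟫ ≤ -(r / 8))
    (hgood : -(r / 5) < ⟪z, 𝕓 0⟫ → ‖gluedW hA r z - 1‖ < 2 ∧ ‖gluedS hA r z‖ < 1) :
    gluedK hA r z = gluedW hA r z := by
  unfold gluedK
  by_cases hif : ⟪z, 𝕓 0⟫ ≤ -(r / 5)
  · rw [if_pos hif]
  · have hlt : -(r / 5) < ⟪z, 𝕓 0⟫ := not_le.1 hif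
    rw [if_neg hif, gluedT, gluedStep_of_le (by rw [div_le_iff₀ hr]; linarith), one_smul, gluedS,
      cayleyU_cayleyUInv (hgood hlt).1 (hgood hlt).2]

end Local

/-! ### Validity of the Cayley pair on the band -/

section Good

/-- The smallness threshold `ε₁ = 1/(32‖1‖(‖1‖ + 1))`. [folklore] -/
def epsOne (N : ℕ) : ℝ := 1 / (32 * ‖(1 : Matrix (Fin N) (Fin N) ℂ)‖ * (‖(1 : Matrix (Fin N) (Fin N) ℂ)‖ + 1))

/-- `⟨c, z⟩ = r z₀` for the pole `c = r e₀`. [folklore] -/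
theorem inner_poleP (r : ℝ) (z : 𝔼) : ⟪poleP r, z⟫ = r * ⟪z, 𝕓 0⟫ := by
  rw [poleP, inner_smul_left, RCLike.conj_to_real, real_inner_comm]

/-- Band membership from `|z₀| ≤ (3/10) r` and `3r/4 ≤ ‖z‖ ≤ 13r/10`. [folklore] -/
theorem inBand_of {r : ℝ} (hr : 0 < r) {z : 𝔼} (h1 : 3 / 4 * r ≤ ‖z‖) (h2 : ‖z‖ ≤ 13 / 10 * r)
    (h3 : -(3 / 10) * r ≤ ⟪z, 𝕓 0⟫) (h4 : ⟪z, 𝕓 0⟫ ≤ 3 / 10 * r) : InBand r (poleP r) z := by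
  refine ⟨h1, h2, ?_, ?_⟩ <;> rw [inner_poleP] <;> nlinarith

/-- **On the band the Cayley pair is valid**: `‖W − 1‖ ≤ 1/2` and `‖S‖ ≤ 1/2` for `ε ≤ ε₁`.
[folklore] -/
theorem glued_good [NeZero N] {A : Connection 𝔼 𝔤} (hA1 : ContDiff ℝ 1 A) (hA : ContDiff ℝ 2 A)
    (hskew : IsSkewValued A) {r ε : ℝ} (hr : 0 < r) (hε0 : 0 ≤ ε) (hε1 : ε ≤ epsOne N)
    (hF : ShellCurvatureBound A r ε) {z : 𝔼} (hz : InBand r (poleP r) z) :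
    ‖gluedW hA1 r z - 1‖ ≤ 1 / 2 ∧ ‖gluedS hA1 r z‖ ≤ 1 / 2 := by
  have h1 : (1 : ℝ) ≤ ‖(1 : 𝔤)‖ := one_le_norm_one 𝔤
  set K := ‖(1 : 𝔤)‖ with hK
  have hW : ‖gluedW hA1 r z - 1‖ ≤ 16 * K * ε := by
    have h := norm_gaugeTransition_mul_star_base_sub_one_le hA hskew hr hε0 hF hz
    exact h
  have hKε : 16 * K * ε * (2 * (K + 1)) ≤ 1 := by
    have : ε * (32 * K * (K + 1)) ≤ 1 := by
      rw [epsOne] at hε1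
      have hpos : 0 < 32 * K * (K + 1) := by positivity
      calc ε * (32 * K * (K + 1)) ≤ 1 / (32 * K * (K + 1)) * (32 * K * (K + 1)) :=
            mul_le_mul_of_nonneg_right hε1 hpos.le
        _ = 1 := by field_simp
    nlinarith
  have hW1 : ‖gluedW hA1 r z - 1‖ ≤ 1 / 2 := by nlinarith
  refine ⟨hW1, ?_⟩
  have hS := norm_cayleyUInv_le (W := gluedW hA1 r z) (by linarith)
  rw [gluedS]
  calc ‖cayleyUInv (gluedW hA1 r z)‖ ≤ 1 / 2 * (K + 1) * ‖gluedW hA1 r z - 1‖ := hS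
    _ ≤ 1 / 2 * (K + 1) * (16 * K * ε) := mul_le_mul_of_nonneg_left hW (by positivity)
    _ ≤ 1 / 2 := by nlinarith

end Good

/-! ### Smoothness on the shell -/

section Smooth

/-- `W` is `C^n`. [folklore] -/
theorem contDiff_gluedW {n : ℕ∞} (hn : 1 ≤ n) {A : Connection 𝔼 𝔤} (hA1 : ContDiff ℝ 1 A)
    (hA : ContDiff ℝ n A) (r : ℝ) : ContDiff ℝ n (gluedW hA1 r) := by
  unfold gluedW
  exact (contDiff_gaugeTransition hn hA _ _).mul contDiff_const

/-- `S` is `C^n` near every point where `‖W − 1‖ < 2`. [folklore] -/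
theorem contDiffAt_gluedS {n : ℕ∞} (hn : 1 ≤ n) {A : Connection 𝔼 𝔤} (hA1 : ContDiff ℝ 1 A)
    (hA : ContDiff ℝ n A) (r : ℝ) {z : 𝔼} (hz : ‖gluedW hA1 r z - 1‖ < 2) :
    ContDiffAt ℝ n (gluedS hA1 r) z := by
  unfold gluedS
  exact (contDiffAt_cayleyUInv hz).comp z (contDiff_gluedW hn hA1 hA r).contDiffAt

/-- `T` is `C^n` near every point where `‖W − 1‖ < 2` (`r ≠ 0`). [folklore] -/
theorem contDiffAt_gluedT {n : ℕ∞} (hn : 1 ≤ n) {A : Connection 𝔼 𝔤} (hA1 : ContDiff ℝ 1 A)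
    (hA : ContDiff ℝ n A) (r : ℝ) {z : 𝔼} (hz : ‖gluedW hA1 r z - 1‖ < 2) :
    ContDiffAt ℝ n (gluedT hA1 r) z := by
  unfold gluedT
  have hχ : ContDiff ℝ n fun y : 𝔼 => gluedStep (⟪y, 𝕓 0⟫ / r) :=
    contDiff_gluedStep.comp ((contDiff_id.inner ℝ contDiff_const).div_const r)
  exact hχ.contDiffAt.smul (contDiffAt_gluedS hn hA1 hA r hz)

/-- **`k` is `C^n` on the shell** `gluedNbhd r` (for `ε ≤ ε₁`). [folklore] -/
theorem contDiffOn_gluedK [NeZero N] {n : ℕ∞} (hn : 1 ≤ n) {A : Connection 𝔼 𝔤}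
    (hA1 : ContDiff ℝ 1 A) (hA2 : ContDiff ℝ 2 A) (hA : ContDiff ℝ n A) (hskew : IsSkewValued A)
    {r ε : ℝ} (hr : 0 < r) (hε0 : 0 ≤ ε) (hε1 : ε ≤ epsOne N) (hF : ShellCurvatureBound A r ε) :
    ContDiffOn ℝ n (gluedK hA1 r) (gluedNbhd r) := by
  have hn1 : 1 ≤ n := hn
  -- goodness on the (open) band
  have hgood : ∀ z : 𝔼, 3 / 4 * r < ‖z‖ → ‖z‖ < 13 / 10 * r → -(3 / 10) * r < ⟪z, 𝕓 0⟫ →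
      ⟪z, 𝕓 0⟫ < 3 / 10 * r → ‖gluedW hA1 r z - 1‖ < 2 ∧ ‖gluedS hA1 r z‖ < 1 := by
    intro z h1 h2 h3 h4
    have hg := glued_good hA1 hA2 hskew hr hε0 hε1 hF (inBand_of hr h1.le h2.le h3.le h4.le)
    exact ⟨by linarith [hg.1], by linarith [hg.2]⟩
  intro z hz
  obtain ⟨hz1, hz2⟩ := hz
  -- locate `z` in one of the open pieces
  by_cases hA8 : r / 8 < ⟪z, 𝕓 0⟫
  · -- `k = 1` near `z`
    have hO : IsOpen {y : 𝔼 | r / 8 < ⟪y, 𝕓 0⟫} := isOpen_lt continuous_const (continuous_id.inner continuous_const)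
    have hev : gluedK hA1 r =ᶠ[𝓝 z] fun _ => (1 : 𝔤) := by
      filter_upwards [hO.mem_nhds hA8] with y hy
      exact gluedK_eq_one_of hA1 hr (le_of_lt hy)
    exact ((contDiffAt_const (c := (1 : 𝔤))).congr_of_eventuallyEq hev).contDiffWithinAt
  · by_cases hB : -(3 / 10) * r < ⟪z, 𝕓 0⟫
    · -- `k = cayleyU ∘ T` near `z` (open band piece)
      have hO : IsOpen {y : 𝔼 | 3 / 4 * r < ‖y‖ ∧ ‖y‖ < 13 / 10 * r ∧ -(3 / 10) * r < ⟪y, 𝕓 0⟫ ∧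
          ⟪y, 𝕓 0⟫ < 3 / 10 * r} := by
        refine (isOpen_lt continuous_const continuous_norm).and
          ((isOpen_lt continuous_norm continuous_const).and
            ((isOpen_lt continuous_const (continuous_id.inner continuous_const)).and
              (isOpen_lt (continuous_id.inner continuous_const) continuous_const)))
      have hzO : z ∈ {y : 𝔼 | 3 / 4 * r < ‖y‖ ∧ ‖y‖ < 13 / 10 * r ∧ -(3 / 10) * r < ⟪y, 𝕓 0⟫ ∧
          ⟪y, 𝕓 0⟫ < 3 / 10 * r} :=
        ⟨by linarith, by linarith, hB, by linarith [not_lt.1 hA8]⟩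
      have hev : gluedK hA1 r =ᶠ[𝓝 z] fun y => cayleyU (gluedT hA1 r y) := by
        filter_upwards [hO.mem_nhds hzO] with y hy
        exact gluedK_eq_cayleyU_of hA1 hr fun _ => hgood y hy.1 hy.2.1 hy.2.2.1 hy.2.2.2
      have hgz := hgood z hzO.1 hzO.2.1 hzO.2.2.1 hzO.2.2.2
      have hT : ContDiffAt ℝ n (gluedT hA1 r) z := contDiffAt_gluedT hn1 hA1 hA r hgz.1
      have hTn : ‖gluedT hA1 r z‖ < 1 := by
        rw [gluedT, norm_smul, Real.norm_eq_abs, abs_of_nonneg (gluedStep_nonneg _)]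
        calc gluedStep (⟪z, 𝕓 0⟫ / r) * ‖gluedS hA1 r z‖ ≤ 1 * ‖gluedS hA1 r z‖ :=
              mul_le_mul_of_nonneg_right (gluedStep_le_one _) (norm_nonneg _)
          _ < 1 := by rw [one_mul]; exact hgz.2
      have hC : ContDiffAt ℝ n (fun y => cayleyU (gluedT hA1 r y)) z :=
        (contDiffAt_cayleyU hTn).comp z hT
      exact (hC.congr_of_eventuallyEq hev).contDiffWithinAt
    · -- `k = W` near `z`
      have hle : ⟪z, 𝕓 0⟫ ≤ -(3 / 10) * r := not_lt.1 hB
      have hO : IsOpen {y : 𝔼 | 3 / 4 * r < ‖y‖ ∧ ‖y‖ < 13 / 10 * r ∧ ⟪y, 𝕓 0⟫ < -(r / 8)} :=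
        (isOpen_lt continuous_const continuous_norm).and
          ((isOpen_lt continuous_norm continuous_const).and
            (isOpen_lt (continuous_id.inner continuous_const) continuous_const))
      have hzO : z ∈ {y : 𝔼 | 3 / 4 * r < ‖y‖ ∧ ‖y‖ < 13 / 10 * r ∧ ⟪y, 𝕓 0⟫ < -(r / 8)} :=
        ⟨by linarith, by linarith, by linarith⟩
      have hev : gluedK hA1 r =ᶠ[𝓝 z] gluedW hA1 r := by
        filter_upwards [hO.mem_nhds hzO] with y hy
        refine gluedK_eq_W_of hA1 hr hy.2.2.le fun h5 => hgood y hy.1 hy.2.1 (by linarith) (by linarith)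
      exact (((contDiff_gluedW hn1 hA1 hA r).contDiffAt).congr_of_eventuallyEq hev).contDiffWithinAt

/-- **The glued gauge is `C^n` on the shell.** [folklore] -/
theorem contDiffOn_gluedGauge [NeZero N] {n : ℕ∞} (hn : 1 ≤ n) {A : Connection 𝔼 𝔤}
    (hA1 : ContDiff ℝ 1 A) (hA2 : ContDiff ℝ 2 A) (hA : ContDiff ℝ n A) (hskew : IsSkewValued A)
    {r ε : ℝ} (hr : 0 < r) (hε0 : 0 ≤ ε) (hε1 : ε ≤ epsOne N) (hF : ShellCurvatureBound A r ε) :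
    ContDiffOn ℝ n (gluedGauge hA1 r) (gluedNbhd r) := by
  unfold gluedGauge
  exact ((contDiff_expGauge hn hA _).contDiffOn).mul
    (contDiffOn_gluedK hn hA1 hA2 hA hskew hr hε0 hε1 hF)

end Smooth

/-! ### Unitarity on the shell -/

section Unitary

/-- `W(z)` is unitary. [folklore] -/
theorem gluedW_mem_unitary {A : Connection 𝔼 𝔤} (hA1 : ContDiff ℝ 1 A) (hskew : IsSkewValued A)
    (r : ℝ) (z : 𝔼) : gluedW hA1 r z ∈ unitary 𝔤 :=
  gaugeTransition_mul_star_mem_unitary hA1 hskew _ _ _ _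

/-- `S(z)` is skew where `‖W(z) − 1‖ < 2`. [folklore] -/
theorem star_gluedS {A : Connection 𝔼 𝔤} (hA1 : ContDiff ℝ 1 A) (hskew : IsSkewValued A) (r : ℝ)
    {z : 𝔼} (hz : ‖gluedW hA1 r z - 1‖ < 2) : star (gluedS hA1 r z) = -gluedS hA1 r z := by
  unfold gluedS
  exact star_cayleyUInv (isUnit_add_one hz) (Unitary.mem_iff.1 (gluedW_mem_unitary hA1 hskew r z)).1

/-- `T(z)` is skew where `‖W(z) − 1‖ < 2`. [folklore] -/
theorem star_gluedT {A : Connection 𝔼 𝔤} (hA1 : ContDiff ℝ 1 A) (hskew : IsSkewValued A) (r : ℝ)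
    {z : 𝔼} (hz : ‖gluedW hA1 r z - 1‖ < 2) : star (gluedT hA1 r z) = -gluedT hA1 r z := by
  unfold gluedT
  rw [star_smul, star_trivial, star_gluedS hA1 hskew r hz, smul_neg]

/-- `‖T(z)‖ ≤ ‖S(z)‖`. [folklore] -/
theorem norm_gluedT_le {A : Connection 𝔼 𝔤} (hA1 : ContDiff ℝ 1 A) (r : ℝ) (z : 𝔼) :
    ‖gluedT hA1 r z‖ ≤ ‖gluedS hA1 r z‖ := by
  rw [gluedT, norm_smul, Real.norm_eq_abs, abs_of_nonneg (gluedStep_nonneg _)]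
  calc gluedStep (⟪z, 𝕓 0⟫ / r) * ‖gluedS hA1 r z‖ ≤ 1 * ‖gluedS hA1 r z‖ :=
        mul_le_mul_of_nonneg_right (gluedStep_le_one _) (norm_nonneg _)
    _ = ‖gluedS hA1 r z‖ := one_mul _

/-- **`k(z)` is unitary on the shell** (for `ε ≤ ε₁`). [folklore] -/
theorem gluedK_mem_unitary [NeZero N] {A : Connection 𝔼 𝔤} (hA1 : ContDiff ℝ 1 A)
    (hA2 : ContDiff ℝ 2 A) (hskew : IsSkewValued A) {r ε : ℝ} (hr : 0 < r) (hε0 : 0 ≤ ε)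
    (hε1 : ε ≤ epsOne N) (hF : ShellCurvatureBound A r ε) {z : 𝔼} (hz : z ∈ gluedNbhd r) :
    gluedK hA1 r z ∈ unitary 𝔤 := by
  obtain ⟨hz1, hz2⟩ := hz
  have hgood : ∀ y : 𝔼, 3 / 4 * r ≤ ‖y‖ → ‖y‖ ≤ 13 / 10 * r → -(3 / 10) * r ≤ ⟪y, 𝕓 0⟫ →
      ⟪y, 𝕓 0⟫ ≤ 3 / 10 * r → ‖gluedW hA1 r y - 1‖ < 2 ∧ ‖gluedS hA1 r y‖ < 1 := by
    intro y h1 h2 h3 h4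
    have hg := glued_good hA1 hA2 hskew hr hε0 hε1 hF (inBand_of hr h1 h2 h3 h4)
    exact ⟨by linarith [hg.1], by linarith [hg.2]⟩
  by_cases hA8 : r / 8 ≤ ⟪z, 𝕓 0⟫
  · rw [gluedK_eq_one_of hA1 hr hA8]; exact Submonoid.one_mem _
  · by_cases hB : -(3 / 10) * r ≤ ⟪z, 𝕓 0⟫
    · have hgz := hgood z (by linarith) (by linarith) hB (by linarith [not_le.1 hA8])
      rw [gluedK_eq_cayleyU_of hA1 hr fun _ => hgz]
      exact cayleyU_mem_unitary ((norm_gluedT_le hA1 r z).trans_lt hgz.2) (star_gluedT hA1 hskew r hgz.1)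
    · rw [gluedK_eq_W_of hA1 hr (by linarith [not_le.1 hB]) fun h5 =>
        hgood z (by linarith) (by linarith) (by linarith) (by linarith)]
      exact gluedW_mem_unitary hA1 hskew r z

/-- **The glued gauge is unitary on the shell.** [folklore] -/
theorem gluedGauge_mem_unitary [NeZero N] {A : Connection 𝔼 𝔤} (hA1 : ContDiff ℝ 1 A)
    (hA2 : ContDiff ℝ 2 A) (hskew : IsSkewValued A) {r ε : ℝ} (hr : 0 < r) (hε0 : 0 ≤ ε)
    (hε1 : ε ≤ epsOne N) (hF : ShellCurvatureBound A r ε) {z : 𝔼} (hz : z ∈ gluedNbhd r) :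
    gluedGauge hA1 r z ∈ unitary 𝔤 :=
  Submonoid.mul_mem _ (expGauge_mem_unitary' hA1 hskew _ _)
    (gluedK_mem_unitary hA1 hA2 hskew hr hε0 hε1 hF hz)

end Unitary

end Literature.MathematicalPhysics.QuantumLattice
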